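import Literature.NumberTheory.NumberFields.EquivariantUnramifiedHomClassGroupCount
import Literature.NumberTheory.NumberFields.EquivariantUnramifiedHomClassGroup
import Literature.NumberTheory.NumberFields.UnramifiedHomsClassGroupPRankBound
import HarnessLib

/-!
# Everywhere-unramified `Γ₀`-equivariant `p`-torsion-valued homomorphisms on an open normal subgroup
# `Gal(K̄/L)` of `Γ_K` are at most as many as the `Γ₀`-equivariant additive maps `Cl(𝓞_L) → M`
# (class field theory, finite level, EQUIVARIANT COUNT; proved)

`Proofs`-style file (theorems only: no definition, no named fact, no `sorry`) in topic
`NumberTheory/NumberFields` (namespace = path, grouping sub-namespace `EquivariantUnramifiedDescent`),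
written by the literature seat `bsd-potss-conjA-anchor` g19 (cell `bsd-potss`; serves the asides
stmt-BirchSwinnertonDyer-19386 / 19413; closes nothing; neither Conjecture A nor BSD is proved for any
curve here).  It is the common EQUIVARIANT refinement of

* `UnramifiedHomsClassGroupPRankBound.card_le_pow_index_of_unramified` (seat k8t-c4 g21: a finite set
  `T` of additive maps `g : U → M` on an open normal `U = Gal(K̄/L) ≤ Γ_K`, killing an open normal
  `W ≤ U` and every `U ∩ I_𝔓`, has `#T ≤ #M ^ rank_p Cl(L)`), and
* `EquivariantUnramifiedDescent.forall_eq_zero_of_forall_equivariantHom_classGroup_eq_zero` (seat g17: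
  ONE such map which is moreover `Γ_K`-equivariant vanishes if `Hom_{Γ_K}(Cl(L), M) = 0`),

namely **`card_le_card_equivariantHom_classGroup_of_unramified`**: if the maps of `T` are EQUIVARIANT
under conjugation by a subgroup `Γ₀ ≤ Γ_K` (`g(γuγ⁻¹) = γ • g(u)`, `γ ∈ Γ₀` — typically
`Γ₀ = Gal(K̄/K_m)`, NOT all of `Γ_K`), then
`#T ≤ #{μ : Cl(𝓞_L) → M additive, μ(γ|_L · c) = γ • μ(c) for all γ ∈ Γ₀}`
(equivariance through `ClassGroup.mulEquiv (intAut (γ|_L))`, the currency of the door-L5/L6 theorems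
and of Deo–Ray–Sujatha's (c2)).

PROOF (g21's construction line by line, with g17's equivariance bookkeeping, closed by g19's counting
form of equivariant Artin reciprocity `EquivariantIwasawaLemma.card_le_card_equivariantHom_classGroup`):
§1 the open subgroup `U' = W·[U,U]·U^p`, normal in `Γ_K`, is killed by every `g ∈ T`; §2 its fixed field
`E' = K̄^{U'}` is finite Galois over `K` and contains `L`; with `Li` the copy of `L` inside `E'`, the
relative restriction `πL : U ↠ G = Gal(E'/Li)` descends each `g` to an additive `ḡ : G → M`
(injectively in `g`); `G` has exponent `p`, hence odd order, so `E'/Li` is unramified at infinity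
(Mathlib `IsUnramifiedAtInfinitePlaces_of_odd_card_aut`); §3 the inertia groups of `G` are restrictions
of absolute inertia groups (tree `inertia_comap_ringOfIntegers_eq_map_absRestrictNormalHom`), so each `ḡ`
kills them; §4 composing with `Gal(H_{E'}/Li) ↠ G` gives additive inertia-trivial `χ_g`, equivariant
under the lifts of `Γ₀` (conjugation formula of g17), pairwise distinct; §5 the counting form of
equivariant Artin reciprocity bounds their number by the `Γ₀`-equivariant additive maps on `Cl(𝓞_{Li})`,
which are transported to `Cl(𝓞_L)` along `L ≃ Li`.

This is the class-field-theoretic half of the cell's ISOTYPIC BOUNDED-MULTIPLICITY criterion for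
Coates–Sujatha's Conjecture A (the `λ`-tolerant form of [CoatesSujatha2005] Lemma 3.8 / Thm. 3.4:
«`sup_n #Hom_{Gal(L_n/K_n)}(Cl(L_n), E[p]) < ∞` along `L_n = K(E[p])·K_n ⟹ (A)`»), assembled in the
topics `IwasawaTheory` (tower) and `EllipticCurves` (fine Selmer group).

References: [Washington1997] §13.3 (Lemma 13.15, Prop. 13.23); [Cox2013] §5.C Cor. 5.24, §8.A Thm. 8.10;
[SerreLocalFields1979] Ch. I §7 Prop. 22 (b); [NeukirchANT1999] Ch. VI (6.9), (7.1), Ch. IV §6;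
[CoatesSujatha2005] §3 Lemma 3.8, Thm. 3.4; [KuriharaPollack2007] §3.1.
-/

set_option autoImplicit false

noncomputable section

open scoped Classical Pointwise NumberField nonZeroDivisors
open NumberField IsDedekindDomain Field IntermediateField Ideal

namespace Literature.NumberTheory.NumberFields

namespace EquivariantUnramifiedDescent

open Literature.NumberTheory.EllipticCurves Literature.NumberTheory.GaloisRepresentations
  Literature.NumberTheory.NumberFields

variable {K : Type} [Field K] [NumberField K]

/-! ## §0 Small group-theoretic and arithmetic helpers (re-proved: the siblings' versions are private) -/

omit [NumberField K] in
/-- An additive map `g` from a group to an abelian group killed by `p` has a kernel SUBGROUP containing the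
commutators and the `p`-th powers. [folklore] -/
private theorem exists_ker_subgroup₂ {G : Type*} [Group G] {M : Type*} [AddCommGroup M]
    (p : ℕ) (hpM : ∀ m : M, p • m = 0) (g : G → M) (hadd : ∀ u v, g (u * v) = g u + g v) :
    ∃ Z : Subgroup G, (∀ x, x ∈ Z ↔ g x = 0) ∧ ⁅(⊤ : Subgroup G), ⊤⁆ ≤ Z ∧
      Subgroup.closure (Set.range fun u : G => u ^ p) ≤ Z := by
  let ĝ : G →* Multiplicative M :=
    { toFun := fun u => Multiplicative.ofAdd (g u)
      map_one' := by
        have h := hadd 1 1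
        rw [mul_one, left_eq_add] at h
        rw [h]; rfl
      map_mul' := fun a b => by rw [hadd, ofAdd_add] }
  refine ⟨ĝ.ker, fun x => ?_, ?_, ?_⟩
  · rw [MonoidHom.mem_ker]
    exact ⟨fun h => Multiplicative.ofAdd.injective h, fun h => by
      change Multiplicative.ofAdd (g x) = 1
      rw [h]; rfl⟩
  · intro y hy
    rw [← commutator_def] at hy
    exact Abelianization.commutator_subset_ker ĝ hy
  · rw [Subgroup.closure_le]
    rintro _ ⟨y, rfl⟩
    rw [SetLike.mem_coe, MonoidHom.mem_ker, map_pow]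
    change Multiplicative.ofAdd (g y) ^ p = 1
    rw [← ofAdd_nsmul, hpM]; rfl

omit [NumberField K] in
/-- A prime of `\bar ℤ_K` above a given maximal ideal of `𝓞 L`, for a number field `L ⊆ K̄`
(integrality of `\bar ℤ_K` over `𝓞 L`); it is maximal. [folklore] -/
private theorem exists_isMaximal_comap_eq₂
    (L : IntermediateField K (AlgebraicClosure K)) (Q : Ideal (𝓞 L)) [hQ : Q.IsMaximal] :
    ∃ 𝔓 : Ideal (absIntegers (𝓞 K) K), 𝔓.IsMaximal ∧
      𝔓.comap (EllipticCurves.ringOfIntegersToIntegralClosure (k := K)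
        (Ω := AlgebraicClosure K) L) = Q := by
  set φ : 𝓞 L →+* absIntegers (𝓞 K) K :=
    EllipticCurves.ringOfIntegersToIntegralClosure (k := K) (Ω := AlgebraicClosure K) L with hφ
  letI : Algebra (𝓞 L) (absIntegers (𝓞 K) K) := φ.toAlgebra
  haveI : IsScalarTower (𝓞 K) (𝓞 L) (absIntegers (𝓞 K) K) :=
    IsScalarTower.of_algebraMap_eq fun x ↦ rfl
  haveI : Algebra.IsIntegral (𝓞 L) (absIntegers (𝓞 K) K) :=
    ⟨fun x ↦ (Algebra.IsIntegral.isIntegral (R := 𝓞 K) x).tower_top⟩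
  obtain ⟨𝔓, -, h𝔓prime, h𝔓Q⟩ := Ideal.exists_ideal_over_prime_of_isIntegral Q
    (⊥ : Ideal (absIntegers (𝓞 K) K))
    (fun x hx ↦ by
      rw [Ideal.mem_comap, Ideal.mem_bot] at hx
      have hx0 : x = 0 :=
        EllipticCurves.ringOfIntegersToIntegralClosure_injective L (hx.trans (map_zero _).symm)
      rw [hx0]
      exact Q.zero_mem)
  haveI := h𝔓prime
  refine ⟨𝔓, Ideal.isMaximal_of_isIntegral_of_isMaximal_comap (R := 𝓞 L) 𝔓 ?_, h𝔓Q⟩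
  rw [h𝔓Q]
  exact hQ

/-- A ring isomorphism maps non-zero ideals to non-zero ideals. [folklore] -/
private theorem map_mem_nonZeroDivisors₂ {R S : Type*} [CommRing R] [IsDomain R] [CommRing S]
    [IsDomain S] (g : R ≃+* S) (J : (Ideal R)⁰) : (J : Ideal R).map (g : R →+* S) ∈ (Ideal S)⁰ := by
  rw [mem_nonZeroDivisors_iff_ne_zero]
  intro h
  exact nonZeroDivisors.ne_zero J.2 ((Ideal.map_eq_bot_iff_of_injective g.injective).mp h)

/-- `ClassGroup.mulEquiv g` on the class of an integral ideal `J` is the class of `g(J)`. [folklore] -/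
private theorem mulEquiv_mk0₂ {R S : Type*} [CommRing R] [IsDedekindDomain R] [CommRing S]
    [IsDedekindDomain S] (g : R ≃+* S) (J : (Ideal R)⁰) :
    ClassGroup.mulEquiv g (ClassGroup.mk0 J) =
      ClassGroup.mk0 ⟨_, map_mem_nonZeroDivisors₂ g J⟩ := by
  have hmk : ∀ I : (FractionalIdeal R⁰ (FractionRing R))ˣ,
      ClassGroup.mulEquiv g (ClassGroup.mk (FractionRing R) I) =
        ClassGroup.mk (FractionRing S) (Units.mapEquiv
          (FractionalIdeal.ringEquivOfRingEquiv (FractionRing R) (FractionRing S) g).toMulEquiv I) :=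
    fun I => by
    rw [ClassGroup.mulEquiv, MulEquiv.trans_apply, MulEquiv.trans_apply, ClassGroup.equiv_mk,
      MulEquiv.symm_apply_eq, ClassGroup.equiv_mk, QuotientGroup.congr_mk']
    congr 1
    ext1
    simp [FractionalIdeal.canonicalEquiv_self]
  rw [← ClassGroup.mk_mk0 (FractionRing R) J, hmk, ← ClassGroup.mk_mk0 (FractionRing S)]
  congr 1
  ext1
  rw [Units.coe_mapEquiv, FractionalIdeal.coe_mk0, FractionalIdeal.coe_mk0]
  exact AmbiguousClass.ringEquivOfRingEquiv_coeIdeal _ _ g J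

/-! ## §1 The subgroup `U' = W · [U,U] · U^p` -/

section Main

variable (p : ℕ) [Fact p.Prime]
  (U : Subgroup (absoluteGaloisGroup K)) [hUn : U.Normal]
  (W : Subgroup (absoluteGaloisGroup K)) [hWn : W.Normal]

omit [NumberField K] [Fact p.Prime] in
/-- The subgroup of `U` generated (inside `U`) by `W ∩ U`, the commutators and the `p`-th powers, pushed to
`Γ_K`, is normal in `Γ_K`. [folklore] -/
private theorem map_subtype_sup_normal₂ :
    ((W.subgroupOf U ⊔ ⁅(⊤ : Subgroup U), ⊤⁆ ⊔
      Subgroup.closure (Set.range fun u : U => u ^ p)).map U.subtype).Normal := by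
  set S : Subgroup U := W.subgroupOf U ⊔ ⁅(⊤ : Subgroup U), ⊤⁆ ⊔
    Subgroup.closure (Set.range fun u : U => u ^ p) with hS
  have hstab : ∀ γ : absoluteGaloisGroup K, S.map (MulAut.conjNormal γ : U ≃* U).toMonoidHom ≤ S := by
    intro γ
    rw [hS, Subgroup.map_sup, Subgroup.map_sup]
    refine sup_le (sup_le ?_ ?_) ?_
    · rintro _ ⟨x, hx, rfl⟩
      have hxW : (x : absoluteGaloisGroup K) ∈ W := Subgroup.mem_subgroupOf.1 hx
      refine Subgroup.mem_sup_left (Subgroup.mem_sup_left (Subgroup.mem_subgroupOf.2 ?_))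
      change (((MulAut.conjNormal γ : U ≃* U) x : U) : absoluteGaloisGroup K) ∈ W
      rw [MulAut.conjNormal_apply]
      exact hWn.conj_mem _ hxW γ
    · rw [Subgroup.map_commutator]
      exact (Subgroup.commutator_mono le_top le_top).trans (le_sup_right.trans le_sup_left)
    · rw [MonoidHom.map_closure]
      refine (Subgroup.closure_mono ?_).trans le_sup_right
      rintro _ ⟨_, ⟨u, rfl⟩, rfl⟩
      exact ⟨(MulAut.conjNormal γ : U ≃* U) u, (map_pow _ u p).symm⟩
  refine ⟨fun n hn γ => ?_⟩
  obtain ⟨x, hx, rfl⟩ := hn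
  have hmem : (MulAut.conjNormal γ : U ≃* U) x ∈ S := hstab γ ⟨x, hx, rfl⟩
  refine ⟨(MulAut.conjNormal γ : U ≃* U) x, hmem, ?_⟩
  rw [Subgroup.coe_subtype, MulAut.conjNormal_apply]

/-! ## §2–§5 The equivariant count -/

set_option maxHeartbeats 4000000 in
set_option synthInstance.maxHeartbeats 200000 in
/-- **Equivariant CFT count (absolute form).**  `K` a number field, `p` an odd prime, `L ⊆ K̄` finite
Galois over `K`, `U = Gal(K̄/L) ≤ Γ_K` (normal; `σ ∈ U ↔ σ|_L = 1`), `W ≤ U` open and normal in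
`Γ_K`, `Γ₀ ≤ Γ_K` any subgroup, `M` a finite `Γ_K`-module with `p·M = 0`.  A finite set `T` of maps
`g : U → M` that are additive, `Γ₀`-equivariant under conjugation (`g(γuγ⁻¹) = γ • g(u)`, `γ ∈ Γ₀`),
kill `W` and kill `U ∩ I_𝔓` for every maximal ideal `𝔓` of `\bar ℤ_K` has
**`#T ≤ #{μ : Cl(𝓞_L) → M additive, Γ₀-equivariant}`** (equivariance through
`ClassGroup.mulEquiv (intAut (γ|_L))`).  See the module docstring for the proof.
[cite: Washington1997, §13.3 Lemma 13.15 and Prop. 13.23] [cite: Cox2013, §5.C Cor. 5.24 and §8.A Thm. 8.10]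
[cite: SerreLocalFields1979, Ch. I §7 Prop. 22(b)]
[cite: NeukirchANT1999, Ch. VI (6.9), (7.1) and Ch. IV §6 (equivariance of the Artin symbol)]
[cite: CoatesSujatha2005, §3 Lemma 3.8 (the `Hom_G(·, E[p])`-count behind Thm. 3.4)] -/
theorem card_le_card_equivariantHom_classGroup_of_unramified (hp : p ≠ 2)
    (L : IntermediateField K (AlgebraicClosure K)) [FiniteDimensional K L] [IsGalois K L]
    (hUL : ∀ σ, σ ∈ U ↔ absRestrictNormalHom L σ = 1)
    (hW : IsOpen (W : Set (absoluteGaloisGroup K))) (hWU : W ≤ U)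
    (Γ₀ : Subgroup (absoluteGaloisGroup K))
    (M : Type) [AddCommGroup M] [Finite M] [DistribMulAction (absoluteGaloisGroup K) M]
    (hpM : ∀ m : M, p • m = 0)
    (T : Finset (U → M))
    (hadd : ∀ g ∈ T, ∀ u v : U, g (u * v) = g u + g v)
    (hequiv : ∀ g ∈ T, ∀ γ ∈ Γ₀, ∀ u u' : U,
      (u' : absoluteGaloisGroup K) = γ * u * γ⁻¹ → g u' = γ • g u)
    (hW0 : ∀ g ∈ T, ∀ u : U, (u : absoluteGaloisGroup K) ∈ W → g u = 0)
    (hI0 : ∀ g ∈ T, ∀ (𝔓 : Ideal (absIntegers (𝓞 K) K)), 𝔓.IsMaximal →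
      ∀ u : U, (u : absoluteGaloisGroup K) ∈ 𝔓.inertia (absoluteGaloisGroup K) → g u = 0) :
    T.card ≤ Nat.card {μ : Additive (ClassGroup (𝓞 L)) →+ M //
      ∀ γ ∈ Γ₀, ∀ c : ClassGroup (𝓞 L),
        μ (Additive.ofMul (ClassGroup.mulEquiv
          (AmbiguousClass.intAut (absRestrictNormalHom L γ)) c)) = γ • μ (Additive.ofMul c)} := by
  have hpr : p.Prime := Fact.out
  haveI : Algebra.IsAlgebraic K (AlgebraicClosure K) := AlgebraicClosure.isAlgebraic K
  haveI : IsGalois K (AlgebraicClosure K) := {}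
  haveI : NumberField L := NumberField.of_module_finite K L
  -- restriction to a normal subfield, applied to an element
  have hres_apply : ∀ (E : IntermediateField K (AlgebraicClosure K)) [Normal K E]
      (σ : absoluteGaloisGroup K) (y : E),
      ((absRestrictNormalHom E σ y : E) : AlgebraicClosure K) = σ • (y : AlgebraicClosure K) :=
    fun E _ σ y => AlgEquiv.restrictNormalHom_apply E _ y
  -- ### §1 the subgroup `U'`
  set S : Subgroup U := W.subgroupOf U ⊔ ⁅(⊤ : Subgroup U), ⊤⁆ ⊔
    Subgroup.closure (Set.range fun u : U => u ^ p) with hS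
  set U' : Subgroup (absoluteGaloisGroup K) := S.map U.subtype with hU'def
  haveI hU'n : U'.Normal := map_subtype_sup_normal₂ p U W
  have hU'le : U' ≤ U := by
    rintro _ ⟨x, -, rfl⟩
    exact x.2
  have hWU' : W ≤ U' := by
    intro w hw
    exact ⟨⟨w, hWU hw⟩, Subgroup.mem_sup_left (Subgroup.mem_sup_left (Subgroup.mem_subgroupOf.2 hw)), rfl⟩
  have hU'open : IsOpen (U' : Set (absoluteGaloisGroup K)) := Subgroup.isOpen_mono hWU' hW
  -- every `g ∈ T` kills `U'`
  have hkill : ∀ g ∈ T, ∀ u : U, (u : absoluteGaloisGroup K) ∈ U' → g u = 0 := by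
    intro g hg u hu
    obtain ⟨x, hx, hxu⟩ := hu
    have hxu' : x = u := Subtype.ext hxu
    subst hxu'
    obtain ⟨Z, hZ, hZc, hZp⟩ := exists_ker_subgroup₂ p hpM g (hadd g hg)
    have hSZ : S ≤ Z :=
      sup_le (sup_le (fun y hy => (hZ y).2 (hW0 g hg y (Subgroup.mem_subgroupOf.1 hy))) hZc) hZp
    exact (hZ x).1 (hSZ hx)
  -- ### §2 the field `E' = K̄^{U'} ⊇ L`
  set E' : IntermediateField K (AlgebraicClosure K) := fixedField U' with hE'def
  have hE'U' : E'.fixingSubgroup = U' := fixingSubgroup_fixedField_of_isOpen U' hU'open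
  haveI : FiniteDimensional K E' := finiteDimensional_fixedField_of_isOpen U' hU'open
  haveI hE'gal : IsGalois K E' := by
    rw [← InfiniteGalois.normal_iff_isGalois, hE'U']; exact hU'n
  haveI : NumberField E' := NumberField.of_module_finite K E'
  have hUfix : ∀ σ, σ ∈ U ↔ ∀ x : L, σ • (x : AlgebraicClosure K) = x := fun σ => by
    rw [hUL, absRestrictNormalHom_eq_one_iff, IntermediateField.mem_fixingSubgroup_iff]
    exact ⟨fun h x => h x x.2, fun h x hx => h ⟨x, hx⟩⟩
  have hLE' : L ≤ E' := by
    rw [hE'def, IntermediateField.le_iff_le]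
    intro σ hσ
    rw [IntermediateField.mem_fixingSubgroup_iff]
    intro x hx
    exact (hUfix σ).1 (hU'le hσ) ⟨x, hx⟩
  -- `L` as an intermediate field `Li` of `E'/K`
  set Li : IntermediateField K E' := IntermediateField.restrict hLE' with hLidef
  set eL : L ≃ₐ[K] Li := IntermediateField.restrict_algEquiv hLE' with heLdef
  have heL : ∀ y : L, (((eL y : Li) : E') : AlgebraicClosure K) = (y : AlgebraicClosure K) :=
    fun _ => rfl
  have hmemL : ∀ x : Li, ((x : E') : AlgebraicClosure K) ∈ L := fun x => (mem_restrict hLE' x.1).1 x.2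
  haveI : IsGalois K Li := IsGalois.of_algEquiv eL
  haveI : FiniteDimensional K Li := IntermediateField.finiteDimensional_left Li
  haveI : NumberField Li := NumberField.of_module_finite K Li
  haveI : IsGalois Li E' := IsGalois.tower_top_of_isGalois K Li E'
  haveI : FiniteDimensional Li E' := Module.Finite.of_restrictScalars_finite K Li E'
  -- the restriction `π : Γ_K → Gal(E'/K)`
  set π : absoluteGaloisGroup K →* (E' ≃ₐ[K] E') := absRestrictNormalHom E' with hπdef
  have hπ : Function.Surjective π := absRestrictNormalHom_surjective E'
  have hval : ∀ (τ : absoluteGaloisGroup K) (x : E'),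
      ((π τ x : E') : AlgebraicClosure K) = τ • (x : AlgebraicClosure K) := hres_apply E'
  have hπ1 : ∀ τ, π τ = 1 ↔ τ ∈ U' := by
    intro τ
    rw [hπdef, absRestrictNormalHom_eq_one_iff]
    exact (SetLike.ext_iff.mp hE'U' _)
  -- `σ ∈ U ↔ π σ fixes Li pointwise`
  have hU1 : ∀ τ : absoluteGaloisGroup K, τ ∈ U ↔ ∀ x : Li, π τ (x : E') = x := by
    intro τ
    rw [hUfix]
    constructor
    · intro h x
      apply Subtype.ext
      rw [hval]
      exact h ⟨_, hmemL x⟩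
    · intro h y
      have := congrArg (fun z : E' => (z : AlgebraicClosure K)) (h (eL y))
      rwa [hval] at this
  -- ### the relative restriction `πL : U → Gal(E'/Li)`
  have hres_mem : ∀ u : U, π (u : absoluteGaloisGroup K) ∈ Li.fixingSubgroup := by
    intro u
    rw [IntermediateField.mem_fixingSubgroup_iff]
    intro x hx
    exact (hU1 u).1 u.2 ⟨x, hx⟩
  let πL : U →* (E' ≃ₐ[Li] E') :=
    (IntermediateField.fixingSubgroupEquiv Li).toMonoidHom.comp
      ((π.comp U.subtype).codRestrict Li.fixingSubgroup hres_mem)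
  have hπL : ∀ u : U, (πL u).restrictScalars K = π (u : absoluteGaloisGroup K) := fun u => rfl
  have hmemU_of : ∀ (σ : absoluteGaloisGroup K) (τ : E' ≃ₐ[Li] E'),
      π σ = τ.restrictScalars K → σ ∈ U := by
    intro σ τ hσ
    rw [hU1]
    intro x
    rw [hσ, AlgEquiv.restrictScalars_apply]
    exact τ.commutes x
  have hπL_surj : Function.Surjective πL := by
    intro τ
    obtain ⟨σ, hσ⟩ := hπ (τ.restrictScalars K)
    refine ⟨⟨σ, hmemU_of σ τ hσ⟩, ?_⟩
    apply AlgEquiv.restrictScalars_injective K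
    rw [hπL]
    exact hσ
  have hπL_one : ∀ u : U, πL u = 1 ↔ (u : absoluteGaloisGroup K) ∈ U' := by
    intro u
    rw [← hπ1, ← hπL]
    constructor
    · intro h; rw [h]; rfl
    · intro h
      apply AlgEquiv.restrictScalars_injective K
      rw [h]; rfl
  -- ### descent of the `g ∈ T` to `ḡ : Gal(E'/Li) → M`
  have hfactor : ∀ g ∈ T, ∀ u₁ u₂ : U, πL u₁ = πL u₂ → g u₁ = g u₂ := by
    intro g hg u₁ u₂ h
    have h1 : πL (u₂⁻¹ * u₁) = 1 := by rw [map_mul, map_inv, h, inv_mul_cancel]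
    have h2 := hkill g hg _ ((hπL_one _).1 h1)
    have h3 : g u₁ = g (u₂ * (u₂⁻¹ * u₁)) := by rw [mul_inv_cancel_left]
    rw [h3, hadd g hg, h2, add_zero]
  let desc : (U → M) → ((E' ≃ₐ[Li] E') → M) := fun g τ => g (Function.surjInv hπL_surj τ)
  have hdesc : ∀ g ∈ T, ∀ u : U, desc g (πL u) = g u := fun g hg u =>
    hfactor g hg _ _ (Function.surjInv_eq hπL_surj (πL u))
  have hdesc_add : ∀ g ∈ T, ∀ a b, desc g (a * b) = desc g a + desc g b := by
    intro g hg a b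
    obtain ⟨x, rfl⟩ := hπL_surj a
    obtain ⟨y, rfl⟩ := hπL_surj b
    rw [← map_mul, hdesc g hg, hdesc g hg, hdesc g hg, hadd g hg]
  -- `G = Gal(E'/Li)` has exponent `p`, hence odd order: `E'/Li` is unramified at the infinite places
  have hexp : ∀ τ : E' ≃ₐ[Li] E', τ ^ p = 1 := by
    intro τ
    obtain ⟨u, rfl⟩ := hπL_surj τ
    rw [← map_pow]
    exact (hπL_one _).2 ⟨u ^ p, Subgroup.mem_sup_right (Subgroup.subset_closure ⟨u, rfl⟩), rfl⟩
  haveI : IsUnramifiedAtInfinitePlaces Li E' := by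
    apply IsUnramifiedAtInfinitePlaces_of_odd_card_aut
    have hG : IsPGroup p (E' ≃ₐ[Li] E') := fun τ => ⟨1, by rw [pow_one]; exact hexp τ⟩
    obtain ⟨k, hk⟩ := hG.exists_card_eq
    rw [hk]
    exact (hpr.odd_of_ne_two hp).pow
  -- ### §3 every `ḡ` kills the inertia groups of `G`
  have hinert : ∀ g ∈ T, ∀ (𝔔 : Ideal (𝓞 E')) [𝔔.IsMaximal],
      ∀ τ ∈ 𝔔.inertia (E' ≃ₐ[Li] E'), desc g τ = 0 := by
    intro g hg 𝔔 _ τ hτ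
    obtain ⟨𝔓, h𝔓max, h𝔓Q⟩ := exists_isMaximal_comap_eq₂ E' 𝔔
    haveI := h𝔓max
    have hτK : τ.restrictScalars K ∈ 𝔔.inertia (E' ≃ₐ[K] E') := by
      rw [AddSubgroup.mem_inertia] at hτ ⊢
      intro x
      rw [RingOfIntegers.restrictScalars_smul]
      exact hτ x
    rw [← h𝔓Q, inertia_comap_ringOfIntegers_eq_map_absRestrictNormalHom E' 𝔓] at hτK
    obtain ⟨σ, hσI, hσ⟩ := hτK
    have hσU : σ ∈ U := hmemU_of σ τ hσ
    have hπσ : πL ⟨σ, hσU⟩ = τ := by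
      apply AlgEquiv.restrictScalars_injective K
      rw [hπL]
      exact hσ
    rw [← hπσ, hdesc g hg]
    exact hI0 g hg 𝔓 h𝔓max ⟨σ, hσU⟩ hσI
  -- ### §4 the Hilbert class field `H = H_{E'}` and `χ_g = ḡ ∘ res`
  haveI : IsScalarTower K E' (hilbertClassField E') :=
    IsScalarTower.of_algebraMap_eq fun x => Subtype.ext (IsScalarTower.algebraMap_apply K E' _ x)
  haveI : IsScalarTower Li E' (hilbertClassField E') :=
    IsScalarTower.of_algebraMap_eq fun x => Subtype.ext (IsScalarTower.algebraMap_apply Li E' _ x)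
  haveI : IsScalarTower K Li (hilbertClassField E') := IsScalarTower.of_algebraMap_eq fun x => by
    rw [IsScalarTower.algebraMap_apply Li E' (hilbertClassField E'),
      ← IsScalarTower.algebraMap_apply K Li E', ← IsScalarTower.algebraMap_apply K E' (hilbertClassField E')]
  haveI : IsGalois Li (hilbertClassField E') := hilbertClassField.isGalois_of_isGalois E' (K := Li)
  set rE : (hilbertClassField E' ≃ₐ[Li] hilbertClassField E') →* (E' ≃ₐ[Li] E') :=
    AlgEquiv.restrictNormalHom E' with hrEdef
  have hrE_apply : ∀ a (x : E'), algebraMap E' (hilbertClassField E') (rE a x) =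
      a (algebraMap E' (hilbertClassField E') x) := fun a x => AlgEquiv.restrictNormal_commutes a E' x
  have hrE_surj : Function.Surjective rE :=
    AlgEquiv.restrictNormalHom_surjective (hilbertClassField E')
  let toChi : (U → M) → ((hilbertClassField E' ≃ₐ[Li] hilbertClassField E') → M) :=
    fun g a => desc g (rE a)
  have htoChi_add : ∀ g ∈ T, ∀ a b, toChi g (a * b) = toChi g a + toChi g b := by
    intro g hg a b
    change desc g (rE (a * b)) = desc g (rE a) + desc g (rE b)
    rw [map_mul, hdesc_add g hg]
  -- the `χ_g` are pairwise distinct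
  have htoChi_inj : Set.InjOn toChi T := by
    intro g₁ hg₁ g₂ hg₂ h
    funext u
    obtain ⟨a, ha⟩ := hrE_surj (πL u)
    have h1 : toChi g₁ a = g₁ u := by change desc g₁ (rE a) = g₁ u; rw [ha, hdesc g₁ hg₁]
    have h2 : toChi g₂ a = g₂ u := by change desc g₂ (rE a) = g₂ u; rw [ha, hdesc g₂ hg₂]
    rw [← h1, ← h2, h]
  -- `χ_g` kills the inertia groups of `Gal(H/Li)` (they restrict into inertia groups of `Gal(E'/Li)`)
  have htoChi_I : ∀ g ∈ T, ∀ (Q' : Ideal (𝓞 (hilbertClassField E'))) [Q'.IsMaximal],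
      ∀ s ∈ Q'.inertia (hilbertClassField E' ≃ₐ[Li] hilbertClassField E'), toChi g s = 0 := by
    intro g hg Q' _ s hs
    haveI : (Q'.under (𝓞 E')).IsMaximal := Ideal.IsMaximal.under (𝓞 E') Q'
    refine hinert g hg (Q'.under (𝓞 E')) (rE s) ?_
    rw [AddSubgroup.mem_inertia] at hs ⊢
    intro y
    change algebraMap (𝓞 E') (𝓞 (hilbertClassField E')) (rE s • y - y) ∈ Q'
    have hsm : algebraMap (𝓞 E') (𝓞 (hilbertClassField E')) (rE s • y) =
        s • algebraMap (𝓞 E') (𝓞 (hilbertClassField E')) y := by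
      apply RingOfIntegers.coe_injective
      change algebraMap E' (hilbertClassField E') ((rE s) (y : E')) =
        s (algebraMap E' (hilbertClassField E') (y : E'))
      exact hrE_apply s (y : E')
    rw [map_sub, hsm]
    exact hs _
  -- `χ_g` is `Γ₀`-equivariant (through `π₀ = π|_{Γ₀}`)
  set π₀ : Γ₀ →* (E' ≃ₐ[K] E') := π.comp Γ₀.subtype with hπ₀def
  have hπ₀ : ∀ τ : Γ₀, π₀ τ = π (τ : absoluteGaloisGroup K) := fun _ => rfl
  have htoChi_equiv : ∀ g ∈ T, ∀ (τ : Γ₀)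
      (a₁ : hilbertClassField E' ≃ₐ[K] hilbertClassField E')
      (a a' : hilbertClassField E' ≃ₐ[Li] hilbertClassField E'),
      AlgEquiv.restrictNormalHom E' a₁ = π₀ τ → (∀ y, a' y = a₁ (a (a₁.symm y))) →
        toChi g a' = τ • toChi g a := by
    intro g hg τ a₁ a a' ha₁ ha'
    obtain ⟨u, hu⟩ := hπL_surj (rE a)
    rw [hπ₀] at ha₁
    -- `a₁` restricts to `π τ` on `E'`
    have hg_apply : ∀ x : E', a₁ (algebraMap E' (hilbertClassField E') x) =
        algebraMap E' (hilbertClassField E') (π (τ : absoluteGaloisGroup K) x) := by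
      intro x
      rw [← ha₁]
      exact (AlgEquiv.restrictNormal_commutes a₁ E' x).symm
    have hg_symm : ∀ x : E', a₁.symm (algebraMap E' (hilbertClassField E') x) =
        algebraMap E' (hilbertClassField E') ((π (τ : absoluteGaloisGroup K))⁻¹ x) := by
      intro x
      apply a₁.injective
      rw [AlgEquiv.apply_symm_apply, hg_apply, ← AlgEquiv.mul_apply, mul_inv_cancel,
        AlgEquiv.one_apply]
    -- `a'` restricts to `πL (τ u τ⁻¹)` on `E'`
    have hconjU : ((τ : absoluteGaloisGroup K) * u * (τ : absoluteGaloisGroup K)⁻¹) ∈ U :=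
      hUn.conj_mem _ u.2 _
    have hconj : rE a' = πL ⟨(τ : absoluteGaloisGroup K) * u * (τ : absoluteGaloisGroup K)⁻¹, hconjU⟩ := by
      apply AlgEquiv.ext
      intro x
      have h1 : algebraMap E' (hilbertClassField E') (rE a' x) =
          algebraMap E' (hilbertClassField E')
            (π (τ : absoluteGaloisGroup K) (rE a ((π (τ : absoluteGaloisGroup K))⁻¹ x))) := by
        rw [hrE_apply, ha', hg_symm, ← hrE_apply, hg_apply]
      have h2 : rE a' x = π (τ : absoluteGaloisGroup K) (rE a ((π (τ : absoluteGaloisGroup K))⁻¹ x)) :=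
        (algebraMap E' (hilbertClassField E')).injective h1
      rw [h2, ← hu]
      apply Subtype.ext
      change ((π (τ : absoluteGaloisGroup K) ((πL u).restrictScalars K
          ((π (τ : absoluteGaloisGroup K))⁻¹ x)) : E') : AlgebraicClosure K) =
        (((πL ⟨(τ : absoluteGaloisGroup K) * u * (τ : absoluteGaloisGroup K)⁻¹, hconjU⟩).restrictScalars K
          x : E') : AlgebraicClosure K)
      rw [hπL, hπL, ← map_inv, hval, hval, hval, hval]
      change (τ : absoluteGaloisGroup K) • ((u : absoluteGaloisGroup K) •
          ((τ : absoluteGaloisGroup K)⁻¹ • (x : AlgebraicClosure K))) =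
        ((τ : absoluteGaloisGroup K) * u * (τ : absoluteGaloisGroup K)⁻¹) • (x : AlgebraicClosure K)
      rw [mul_smul, mul_smul]
    change desc g (rE a') = τ • desc g (rE a)
    rw [hconj, hdesc g hg, ← hu, hdesc g hg, Subgroup.smul_def]
    exact hequiv g hg (τ : absoluteGaloisGroup K) τ.2 u _ rfl
  -- ### §5 the counting form of equivariant Artin reciprocity, applied to `T.image toChi`
  set T' : Finset ((hilbertClassField E' ≃ₐ[Li] hilbertClassField E') → M) := T.image toChi with hT'def
  have hT'card : T'.card = T.card := Finset.card_image_of_injOn htoChi_inj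
  have hcount := EquivariantIwasawaLemma.card_le_card_equivariantHom_classGroup (k := K) (B := Li)
    (F := E') π₀ T'
    (fun χ hχ => by
      obtain ⟨g, hg, rfl⟩ := Finset.mem_image.1 hχ
      exact htoChi_add g hg)
    (fun χ hχ Q' _ s hs => by
      obtain ⟨g, hg, rfl⟩ := Finset.mem_image.1 hχ
      exact htoChi_I g hg Q' s hs)
    (fun χ hχ τ a₁ a a' ha₁ ha' => by
      obtain ⟨g, hg, rfl⟩ := Finset.mem_image.1 hχ
      exact htoChi_equiv g hg τ a₁ a a' ha₁ ha')
  -- ### transport from `Li` to `L` along `eL`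
  set gL : 𝓞 L ≃+* 𝓞 Li := RingOfIntegers.mapRingEquiv eL.toRingEquiv with hgLdef
  set eCl : ClassGroup (𝓞 L) ≃* ClassGroup (𝓞 Li) := ClassGroup.mulEquiv gL with heCldef
  have hgcomp : ∀ τ : absoluteGaloisGroup K,
      (gL : 𝓞 L →+* 𝓞 Li).comp (AmbiguousClass.intAut (absRestrictNormalHom L τ) : 𝓞 L →+* 𝓞 L) =
        (AmbiguousClass.intAut ((π τ).restrictNormal Li) : 𝓞 Li →+* 𝓞 Li).comp
          (gL : 𝓞 L →+* 𝓞 Li) := by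
    intro τ
    refine RingHom.ext fun y => Subtype.ext <| Subtype.ext <| Subtype.ext ?_
    change (((eL (absRestrictNormalHom L τ (y : L)) : Li) : E') : AlgebraicClosure K) =
      ((algebraMap Li E' (((π τ).restrictNormal Li) (eL (y : L))) : E') : AlgebraicClosure K)
    rw [AlgEquiv.restrictNormal_commutes, heL, hres_apply L, hval]
    rfl
  have hcomp : ∀ (τ : absoluteGaloisGroup K) (c : ClassGroup (𝓞 L)),
      eCl (ClassGroup.mulEquiv (AmbiguousClass.intAut (absRestrictNormalHom L τ)) c) =
        ClassGroup.mulEquiv (AmbiguousClass.intAut ((π τ).restrictNormal Li)) (eCl c) := by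
    intro τ c
    obtain ⟨J, rfl⟩ := ClassGroup.mk0_surjective c
    rw [AmbiguousClass.mulEquiv_mk0, heCldef, mulEquiv_mk0₂, mulEquiv_mk0₂,
      AmbiguousClass.mulEquiv_mk0]
    congr 1
    apply Subtype.ext
    change ((J : Ideal (𝓞 L)).map _).map _ = ((J : Ideal (𝓞 L)).map _).map _
    rw [Ideal.map_map, Ideal.map_map, hgcomp]
  -- the target subtype on `L` is finite
  haveI : Finite {μ : Additive (ClassGroup (𝓞 L)) →+ M //
      ∀ γ ∈ Γ₀, ∀ c : ClassGroup (𝓞 L),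
        μ (Additive.ofMul (ClassGroup.mulEquiv
          (AmbiguousClass.intAut (absRestrictNormalHom L γ)) c)) = γ • μ (Additive.ofMul c)} :=
    Finite.of_injective (fun ν => ((ν.1 : Additive (ClassGroup (𝓞 L)) →+ M) :
        Additive (ClassGroup (𝓞 L)) → M))
      (fun ν ν' h => Subtype.ext (DFunLike.coe_injective h))
  -- the transport map `μ ↦ μ ∘ eCl`
  let Ψ : {μ : Additive (ClassGroup (𝓞 Li)) →+ M //
      ∀ (τ : Γ₀) (c : ClassGroup (𝓞 Li)),
        μ (Additive.ofMul (ClassGroup.mulEquiv (AmbiguousClass.intAut ((π₀ τ).restrictNormal Li)) c)) =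
          τ • μ (Additive.ofMul c)} →
      {μ : Additive (ClassGroup (𝓞 L)) →+ M //
        ∀ γ ∈ Γ₀, ∀ c : ClassGroup (𝓞 L),
          μ (Additive.ofMul (ClassGroup.mulEquiv
            (AmbiguousClass.intAut (absRestrictNormalHom L γ)) c)) = γ • μ (Additive.ofMul c)} :=
    fun ν => ⟨AddMonoidHom.mk' (fun a => ν.1 (Additive.ofMul (eCl (Additive.toMul a))))
        (fun a b => by simp only [toMul_add, map_mul, ofMul_mul, map_add]),
      fun γ hγ c => by
        simp only [AddMonoidHom.mk'_apply, toMul_ofMul]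
        rw [hcomp, ← hπ₀ ⟨γ, hγ⟩, ν.2 ⟨γ, hγ⟩ (eCl c), Subgroup.mk_smul]⟩
  have hΨval : ∀ ν (c : ClassGroup (𝓞 L)), (Ψ ν).1 (Additive.ofMul c) = ν.1 (Additive.ofMul (eCl c)) :=
    fun ν c => by simp only [Ψ, AddMonoidHom.mk'_apply, toMul_ofMul]
  have hΨ : Function.Injective Ψ := by
    intro ν ν' h
    apply Subtype.ext
    refine AddMonoidHom.ext fun a => ?_
    obtain ⟨c, rfl⟩ : ∃ c : ClassGroup (𝓞 Li), Additive.ofMul c = a := ⟨Additive.toMul a, rfl⟩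
    have h1 := hΨval ν (eCl.symm c)
    have h2 := hΨval ν' (eCl.symm c)
    rw [MulEquiv.apply_symm_apply] at h1 h2
    rw [← h1, ← h2, h]
  exact (le_of_eq hT'card.symm).trans (hcount.trans (Nat.card_le_card_of_injective Ψ hΨ))

end Main

end EquivariantUnramifiedDescent

end Literature.NumberTheory.NumberFields

end
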